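import Literature.MathematicalPhysics.QuantumFieldTheory.Balaban1985CMP102.SectB
import Literature.MathematicalPhysics.QuantumFieldTheory.Balaban1985CMP102.Theorems
import Literature.MathematicalPhysics.QuantumFieldTheory.Balaban1983to89.B10Eq2DensityTower
import Literature.MathematicalPhysics.QuantumFieldTheory.Balaban1983to89.B10Assembly
import Literature.MathematicalPhysics.QuantumFieldTheory.Balaban1983to89.Node00.Record5C

/-!
# `B10RunsOfRecord` — the [Balaban1985UV3] run family OF PRINT on SU(N), Literature-side, with the constants of the construction pinned by the
# printed existential, and node N08 at any record binding it: the `b10` leaf ⟺ Thm 1 (compact reading) ∧ Thm 2 AS PRINTED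

T. Bałaban, *Ultraviolet stability of three-dimensional lattice pure gauge field theories*, Commun. Math. Phys. **102** (1985) 255–275
[Balaban1985UV3] (cell paper B10; PDF page = journal page − 254).  TRACK A (YM-PLAN §2b, node N08 of 28), seat `pub-ymgap-dag-n08-a` (KNIT-BY-NAME;
HUMAN RULING D-0062); reading note `HOME/pub-ymgap-dag-n08-a/N08-STAGE4-READING-NOTE.md`.  A CANDIDATE OBJECT for NODE 00's Stage 4 «X.B10» (the
B10-group pin of the residual carriers `Node00.Residual₅.X`), defined for the record in this module's own namespace and BOUND NOWHERE (the Stage-4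
assembly `Node00/Record<s>.lean` is the node00-def lineage's).

## What the DAG leaf reads, and what the tree already has
The `b10` leaf of the C-binding of record (`Node00.upOfRecord₅C_b10_iff`, chair R434 (Q2) = (C)) reads a `B10.RunData` FAMILY:
`B10.Thm1PrintedCompact X.runs10 ∧ B10.Thm2Printed X.runs10`.  Every `RunData` field of PRINT's run is a landed Literature object: one lattice
approximation `Balaban1985CMP102.Setting.Scales L` (p. 256 L14–18: `ε`, `ε₀` with `L^Kε = ε₀`, `g`, `g²ε₀ ≤ 1`), its run objects
`Setting.RunObjects S G` (binders `E`, `ε₁`, `Ū`, `T`, `reg`, `U_k`, the (41)∕(47) slot; `ρ_k := T^kρ₀` WITH BODY; `toRunData`), the family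
`Theorems.Family L eps0` (p. 256 L15–18 «ε₀ … depending on the coupling constant g only»), and PRINT's own averaging and transformation on SU(N) for
every `P : Params`, hypothesis-free: `B10Eq2DensityTower.blockAvgStd ∕ rtOpIBlockAvgStd ∕ hac_expMeanLogSU_SUN` (the exp-mean-log block averaging of
[Balaban1985Averaging] (15) in the tree's (0.4) reading and its Radon–Nikodym transport — the mechanism of NODE 00's `avOfRecord` ∕ `TrhoOfRecord`, read
at `d = 3`).

## What this file adds (definitions + kernel bookkeeping; NOTHING of the paper asserted)
* §1 `PrintedCarriersR.withRuns10` — re-binding the B10 group of a carrier bundle to a `RunData` family (`withTowerRuns10` is its `toRunData` instance).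
* §2 `Backgrounds N L` (the [Balaban1985Variational] minimisers `U_k` and their regular classes on the d = 3 lattices, as binders) and `Consts L` (the
  construction's constants print quantifies EXISTENTIALLY: `eps0` «depending on g only» p. 256 L16–17, the vacuum energy `E` «defined … during the proof»
  p. 256 L5–9, `b₀`, `p₀` of (7) p. 257, the radius `εbg` of [7]'s regular class) with the printed admissible ranges `Consts.Adm` (positivity ∕ `p₀ > 2` ∕
  `g²ε₀(g) ≤ 1` only — NO estimate); §3′ PRINT'S OWN backgrounds `Backgrounds.ofPrint N L c` = def-B's `Node00.BackgroundActionOfRecord.Uk` idiom (chair R434 (c2):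
  `Classical.choose` a minimiser when one exists, else `1`) read at `d = 3` (`bgReg3`, `UkExists3`, `Uk3`, `isBackground_Uk3`), and the in-edge b11 ([7] Thm 1,
  hypothesis `hB11`) closing the spine's `IsMinimalConfig` BY NAME (`isMinimalConfig_ofPrint`).
* §3 `runObjectsOfPrint N 𝔅 c S : RunObjects S (SU N)` for any background assignment `𝔅 : Consts L → Backgrounds N L` (print's, or a [B11]-pin's) — `Ū`, `T` :=
  print's (above), `ε₁ k := g_k p(g_k)` ((7) read at step k, Sect. D p. 272), `E := c.E S`, `reg ∕ U_k := 𝔅 c`, and the (41)∕(47) slot in the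
  ∃-REPRESENTATION READING `Repr41_47` («ρ_k admits the representation (38)–(47) of Sect. B by tower
  objects `SectB.TowerObjects` over THESE run objects, whose pieces carry a `B10Assembly.LeafSystem`, and (41)_k, (47)_k hold for it» — typed over the
  slot-free objects `runObjects₀`, no circularity); `runsAt N 𝔅 c : Family L c.eps0 → RunData`; `b10At` = Thm 1-compact ∧ Thm 2 at the constants `c`;
  `PrintedUV3 N L 𝔅 := ∃ c, c.Adm ∧ b10At N 𝔅 c` — THE PRINTED PAIR OF THEOREMS with their printed ∃-prefix.  §3a: these densities ARE lit-balaban's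
  hypothesis-free printed tower `towerPrintedSUNFree` (`rho_eq_towerPrintedSUNFree`), whence display (6) p. 257 `∫dV_kρ_k = Z^ε` for print's run is a
  THEOREM in the spine's letters (`eq6_runObjectsOfPrint : (runObjectsOfPrint …).Eq6`); §3b: tower objects with UNIFORM leaf systems on these runs give both
  printed theorems (`b10At_of_uniformLeafSystems`, transport `bounds5At_pin_iff_of_eq`) — the shape the lane pub-balaban3d's end theorem delivers.
* §4 the pin: `constsOfRecord := if h : PrintedUV3 … then Classical.choose h else Consts.junk` (the chair's R434 (c2) idiom applied to the printed
  existential) and `runsOfRecord`; the kernel fact `b10At N 𝔅 (constsOfRecord N 𝔅) ↔ PrintedUV3 N L 𝔅`, whence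
  **`b10Compact (X.withRuns10 (runsOfRecord N 𝔅)) ↔ PrintedUV3 N L 𝔅`**.
* §5 N08 at a world bound by the C-binding of record whose residual B10 group IS `runsOfRecord`: the leaf `b10` ⟺ `PrintedUV3`, the node
  `Dag.B10_main (leavesP w P)` ⟸ `PrintedUV3` (in-edges unused) and ⟺ «in-edges ⇒ `PrintedUV3`»; the «slots» form over `Node00.IsRecordOfRecord₅C`.
* §6 non-vacuity of the family (every admissible `eps0`, every coupling, arbitrarily fine lattices).

HONEST FRAMING: statement-level skeleton of published theorems with citation tags; proofs where landed; nothing here is a claim about the Yang–Mills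
mass gap.  `PrintedUV3` is NOT proved (it is [B10]'s content — the object gap of N08); N08 is NOT discharged; counts unmoved; the d = 3 lattices of
[B10] inside the d = 4 record; one finite torus per run at fixed spacing — NOT ℝ³ ∕ ℝ⁴ ∕ OS ∕ mass gap ∕ Clay.
-/

noncomputable section

namespace Literature.MathematicalPhysics.QuantumFieldTheory.Balaban1983to89.B10RunsOfRecord

open Balaban1985CMP102 Balaban1985CMP102.Setting Balaban1985CMP102.Theorems
open DagBinding DagDischarged B10Eq2DensityTower

/-! ## §1. Re-binding the B10 group of a carrier bundle to a `RunData` family -/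

/-- Binding carriers whose B10 data ARE the `RunData` family `r : I → B10.RunData`; every other field of `X` unchanged.  (The tree's
`PrintedCarriersR.withTowerRuns10 X T` is the instance `r := fun i => (T i).toRunData`, `withTowerRuns10_eq_withRuns10`.) [cite: Balaban1985UV3, Thm 1 p.257 (the run family the leaf reads; bookkeeping)] -/
def _root_.Literature.MathematicalPhysics.QuantumFieldTheory.Balaban1983to89.DagBinding.PrintedCarriersR.withRuns10
    (X : PrintedCarriersR) {I : Type} (r : I → B10.RunData) : PrintedCarriersR :=
  { X with I10 := I, runs10 := r }

variable (X : PrintedCarriersR) {I : Type} (r : I → B10.RunData)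

/-- The re-bound run family (`rfl`). [cite: Balaban1985UV3, Thm 1 p.257 (bookkeeping)] -/
theorem withRuns10_runs10 : (X.withRuns10 r).runs10 = r := rfl

/-- `withTowerRuns10` IS `withRuns10` at the `toRunData` family (`rfl`). [cite: Balaban1985UV3, (41) + (47) pp.266–267 (bookkeeping)] -/
theorem withTowerRuns10_eq_withRuns10 {J : Type} (T : J → B10.TowerRun) :
    X.withTowerRuns10 T = X.withRuns10 (fun j => (T j).toRunData) := rfl

/-- The Stage-3 substitutions of record commute with re-binding the B10 runs (`carriers₃` touches the B4 ∕ B5 ∕ B6 ∕ B7 groups only; `rfl`).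
[cite: Balaban1984PropagatorsII, pp.223–250 (the Stage-3 carriers of record; bookkeeping)] -/
theorem carriers₃_withRuns10 (θ : Node00.Stage3Params) :
    Node00.carriers₃ θ (X.withRuns10 r) = (Node00.carriers₃ θ X).withRuns10 r := rfl

/-- The compact node over re-bound carriers, unfolded (`Iff.rfl`). [cite: Balaban1985UV3, Thm 1 p.257 (compact reading) + Thm 2 p.272] -/
theorem b10Compact_withRuns10_iff :
    b10Compact (X.withRuns10 r).toPrintedCarriers ↔ B10.Thm1PrintedCompact r ∧ B10.Thm2Printed r := Iff.rfl

/-! ## §2. The inputs of the pin: the [B11] backgrounds and the construction's constants -/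

/-- **The [B11] input of the B10 pin**: for every lattice approximation `S` and step `k`, the space `reg S k` of regular configurations of
[Balaban1985Variational] ((2), (6), (8) pp. 278–279) on the finest lattice and the minimal configuration `U_k(V)` «constructed in [7] and determined by the
configuration U on T₁^{(k)}» ((5) p. 256 L35–36) — the binders `Setting.RunObjects.reg ∕ Uk`.  Supplied either by the [B11] pin of the record (NODE 00
Stage 3′Z) or by PRINT'S OWN INSTANCE `Backgrounds.ofPrint` below (def-B's `Classical.choose` idiom of record, read at d = 3); in both cases a function of the
construction's constants (the class radius `εbg`). [cite: Balaban1985UV3, (5) p.256; Balaban1985Variational, Thm 1 p.279] -/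
structure Backgrounds (N L : ℕ) where
  /-- the regular class of [7] at step `k` (configurations on the finest lattice `T_η`) -/
  reg : ∀ S : Scales L, ℕ → Set (GaugeField S.P 0 (Node00.SU N))
  /-- `U_k(V)`, the minimal configuration of [7] determined by `V` on `T₁^{(k)}` -/
  Uk : ∀ (S : Scales L) (k : ℕ), GaugeField S.P k (Node00.SU N) → GaugeField S.P 0 (Node00.SU N)

/-- **The constants of the construction that print quantifies existentially**: the terminal-spacing function `eps0` (p. 256 L16–17 «ε₀ is a positive
constant depending on the coupling constant g only»), the vacuum energy `E` of (1) per lattice approximation (p. 256 L5–9 «This constant can be defined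
perturbatively … but we prefer to give an inductive definition during the proof»; = `Σ_{j<K} E^{(j)}` by (36) p. 265, (62) p. 271, (64) p. 273), and
`b₀`, `p₀` of (7) p. 257 L33–35 («p(g) = b₀(1 + log g⁻¹)^{p₀}, p₀ > 2 and b₀ is a sufficiently large absolute constant»). [cite: Balaban1985UV3, (1) p.256, p.256 L15–18, (7) p.257] -/
structure Consts (L : ℕ) where
  /-- «ε₀ … depending on the coupling constant g only» -/
  eps0 : ℝ → ℝ
  /-- the constant `E` of (1) for the approximation `S` -/
  E : Scales L → ℝ
  /-- `b₀` of (7) -/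
  b₀ : ℝ
  /-- `p₀` of (7) -/
  p₀ : ℝ
  /-- the radius of the regular class of [Balaban1985Variational] (2) p. 278 in which `U_k` is minimal (η²-scaled plaquette variables; the d = 3 twin of
  def-B's `ε` in `Node00.BackgroundActionOfRecord.bgReg`, [Balaban1987RG1] (1.2)) -/
  εbg : ℝ

/-- **The printed admissible ranges of the constants**: `ε₀(g) > 0` and `g²ε₀(g) ≤ 1` for every `g > 0` (p. 256 L16–17 with the spine's normalisation
`Scales.gK_le_one` of «g_k sufficiently small», `g_K² = g²ε₀`), `b₀ > 0`, `p₀ > 2` ((7) p. 257), `εbg > 0` (a non-empty regular class, as def-B's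
`Node00.Stage8Params.Admissible`).  NO estimate. [cite: Balaban1985UV3, p.256 L15–18, (7) p.257; Balaban1985Variational, (2) p.278] -/
def Consts.Adm {L : ℕ} (c : Consts L) : Prop :=
  (∀ g : ℝ, 0 < g → 0 < c.eps0 g ∧ g ^ 2 * c.eps0 g ≤ 1) ∧ 0 < c.b₀ ∧ 2 < c.p₀ ∧ 0 < c.εbg

/-- A documented JUNK admissible value (`ε₀(g) = 1/(1 + g²)`, `E = 0`, `b₀ = 1`, `p₀ = 3`, `εbg = 1`) — the `else` branch of the pin `constsOfRecord`.
[cite: Balaban1985UV3, p.256 L15–18 (bookkeeping; junk value documented per CONVENTIONS §4)] -/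
def Consts.junk (L : ℕ) : Consts L where
  eps0 := fun g => (1 + g ^ 2)⁻¹
  E := fun _ => 0
  b₀ := 1
  p₀ := 3
  εbg := 1

/-- The junk value is admissible. [cite: Balaban1985UV3, p.256 L15–18 (bookkeeping)] -/
theorem Consts.junk_adm (L : ℕ) : (Consts.junk L).Adm := by
  refine ⟨fun g _ => ⟨?_, ?_⟩, by norm_num [Consts.junk], by norm_num [Consts.junk], by norm_num [Consts.junk]⟩
  · show 0 < (1 + g ^ 2)⁻¹
    positivity
  · show g ^ 2 * (1 + g ^ 2)⁻¹ ≤ 1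
    rw [← div_eq_mul_inv, div_le_one (by positivity)]
    linarith [sq_nonneg g]

/-! ## §3. Print's run objects on SU(N), the ∃-representation reading of the (41)∕(47) slot, the family, and the printed theorems -/

section RunObjectsOfPrint

variable (N : ℕ) [NeZero N] {L : ℕ}

/-- **Print's averaging operations** `U ↦ Ū` of [Balaban1985Averaging] (15) on SU(N) along the lattices of `S` — the tree's exp-mean-log block averaging
`blockAvgStd S.P (Node00.SU N) expMeanLogSU` (the standing-range family of `B10Eq2DensityTower`; = NODE 00's `avOfRecord` mechanism at `d = 3`).
[cite: Balaban1985UV3, (2) p.256; Balaban1985Averaging, (15) p.19] -/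
def avOfPrint (S : Scales L) : ∀ j, Averaging S.P j (Node00.SU N) :=
  blockAvgStd S.P (Node00.SU N) ExpMeanLog.expMeanLogSU

/-- **Print's renormalization transformations** `T` of (2) = [Balaban1985Averaging] (10) along `avOfPrint`, as operators on integrable densities,
HYPOTHESIS-FREE on SU(N), every `N ≥ 1` (`rtOpIBlockAvgStd` at the tree's bracket `hac_expMeanLogSU_SUN`). [cite: Balaban1985UV3, (2) p.256; Balaban1985Averaging, (10) p.19] -/
def TOfPrint (S : Scales L) : ∀ j, RTOpI S.P j (Node00.SU N) (avOfPrint N S j) :=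
  rtOpIBlockAvgStd S.P (Node00.SU N) ExpMeanLog.expMeanLogSU ExpMeanLog.measurable_expMeanLogSU_E (hac_expMeanLogSU_SUN S.P)

/-- **`ε₁` of (4) at step `k`**, by (7) p. 257 L33–35 «we take ε₁ = g₀p(g₀)» read at the running coupling (Sect. D p. 272 L30–33: the restrictions
«|U_k(∂p) − 1| < g_kp(g_k)η²»): `ε₁(k) = g_k p(g_k)`, `p = B10.pFun b₀ p₀`. [cite: Balaban1985UV3, (7) p.257, (47) p.267] -/
def eps1OfPrint (c : Consts L) (S : Scales L) (k : ℕ) : ℝ :=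
  S.gk k * B10.pFun c.b₀ c.p₀ (S.gk k)

/-! ### §3′. Print's own backgrounds on the d = 3 lattices: def-B's idiom of record (`Node00.BackgroundActionOfRecord.Uk`) read at `d = 3` -/

/-- **The regular class of [7] at step `k`** on the finest lattice of `S`: plaquette variables within `εbg·η²`, `η = L^{−k}` — the d = 3 twin of def-B's
`Node00.BackgroundActionOfRecord.bgReg` ([Balaban1987RG1] (1.2)); [Balaban1985Variational] (2) p. 278. [cite: Balaban1985Variational, (2) p.278] -/
def bgReg3 (S : Scales L) (k : ℕ) (εbg : ℝ) : Set (GaugeField S.P 0 (Node00.SU N)) :=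
  {U | PlaqSmall (εbg * S.eta k ^ 2) U}

/-- Membership in the regular class, unfolded (`Iff.rfl`). [cite: Balaban1985Variational, (2) p.278 (bookkeeping)] -/
theorem mem_bgReg3_iff (S : Scales L) (k : ℕ) (εbg : ℝ) (U : GaugeField S.P 0 (Node00.SU N)) :
    U ∈ bgReg3 N S k εbg ↔ PlaqSmall (εbg * S.eta k ^ 2) U := Iff.rfl

/-- **«there exists … a minimal orbit» at d = 3 — the EXISTENCE clause of [Balaban1985Variational] Thm 1 as a NAMED Prop** (the content of N08's in-edge
b11 for the lattices of [B10]): the variational problem (42) p. 266 ∕ [7] (3)+(5) p. 278 — `A(U) → min` on `{U : Ū^k = V}` within `bgReg3` along print's averaging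
`avOfPrint` — has a solution (`Setup.IsBackground`).  A hypothesis wherever used, never asserted. [cite: Balaban1985Variational, Thm 1 p.279] -/
def UkExists3 (S : Scales L) (k : ℕ) (εbg : ℝ) (V : GaugeField S.P k (Node00.SU N)) : Prop :=
  ∃ U₀ : GaugeField S.P 0 (Node00.SU N), IsBackground (avOfPrint N S) (bgReg3 N S k εbg) k V U₀

/-- **`U_k(V)` OF PRINT at d = 3** ((5) p. 256 L35–36 «the minimal configuration constructed in [7] and determined by the configuration U on T₁^{(k)}»):
a TOTAL definition choosing a solution of the variational problem when one exists (`UkExists3`) and the unit configuration otherwise — def-B's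
`Node00.BackgroundActionOfRecord.Uk` idiom (chair R434 (c2)) verbatim at `d = 3`. [cite: Balaban1985UV3, (5) p.256; Balaban1985Variational, Thm 1 p.279] -/
def Uk3 (S : Scales L) (k : ℕ) (εbg : ℝ) (V : GaugeField S.P k (Node00.SU N)) : GaugeField S.P 0 (Node00.SU N) := by
  classical
  exact if h : UkExists3 N S k εbg V then Classical.choose h else 1

/-- **The characterising property**: whenever the problem at `V` is solvable — in print, by [7] Thm 1 — `Uk3 … V` IS a minimiser of `A` on `{Ū^k = V}` within
the regular class. [cite: Balaban1985Variational, Thm 1 p.279] -/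
theorem isBackground_Uk3 {S : Scales L} {k : ℕ} {εbg : ℝ} {V : GaugeField S.P k (Node00.SU N)} (h : UkExists3 N S k εbg V) :
    IsBackground (avOfPrint N S) (bgReg3 N S k εbg) k V (Uk3 N S k εbg V) := by
  classical
  unfold Uk3
  rw [dif_pos h]
  exact Classical.choose_spec h

/-- Off the solvable set `Uk3` is the unit configuration (documented junk default). [cite: Balaban1985Variational, Thm 1 p.279 (bookkeeping)] -/
theorem Uk3_of_not {S : Scales L} {k : ℕ} {εbg : ℝ} {V : GaugeField S.P k (Node00.SU N)} (h : ¬ UkExists3 N S k εbg V) :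
    Uk3 N S k εbg V = 1 := by
  classical
  unfold Uk3
  rw [dif_neg h]

variable (L) in
/-- **PRINT'S OWN BACKGROUNDS** as a function of the construction's constants (the class radius `c.εbg`): `reg := bgReg3`, `U_k := Uk3`.
[cite: Balaban1985UV3, (5) p.256; Balaban1985Variational, Thm 1 p.279] -/
def Backgrounds.ofPrint : Consts L → Backgrounds N L :=
  fun c => ⟨fun S k => bgReg3 N S k c.εbg, fun S k V => Uk3 N S k c.εbg V⟩

variable (𝔅 : Consts L → Backgrounds N L) (c : Consts L)

/-- **Print's run objects at the constants `c` and the backgrounds `𝔅 c`, SLOT-FREE** (`𝔅 : Consts L → Backgrounds N L` — print's `Backgrounds.ofPrint N L`, or a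
[B11]-pin-supplied assignment): `E := c.E S`, `ε₁` by (7), `Ū ∕ T` print's, `reg ∕ U_k := 𝔅 c`, and the
(41)∕(47) slot left at `True` — the object the ∃-representation reading quantifies tower objects OVER (`Repr41_47`), so that the reading is not circular.
[cite: Balaban1985UV3, (1)–(6) pp.256–257] -/
def runObjects₀ (S : Scales L) : RunObjects S (Node00.SU N) where
  E := c.E S
  ε₁ := eps1OfPrint c S
  av := avOfPrint N S
  T := TOfPrint N S
  reg := (𝔅 c).reg S
  Uk := (𝔅 c).Uk S
  ineq41_47 := fun _ => True

/-- **THE ∃-REPRESENTATION READING of «ρ_k satisfies the inequalities (41), (47)»** (Thm 2 p. 272; (41) p. 266, (47) p. 267): there are tower objects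
`W : SectB.TowerObjects S (Node00.SU N)` of Sect. B ((38)–(43): large-field histories, the functional of (41), the history-dependent minimisers (42), the interaction
sum (43), `|Λ_k|`, `|Z_j|`, `E^{(j)}`, the O(·)-coefficients) EXTENDING EXACTLY these run objects (`W.toRunObjects = runObjects₀ … S`), whose pieces obey the
printed bounds packaged as a `B10Assembly.LeafSystem` ((25) p. 262, (44)–(46) p. 267, (62)–(65) pp. 271–273, the large-field control pp. 273–274), and for
which (41)_k and (47)_k hold (`W.pin` = the spine's binding of the slot to the typed displays, `SectB.TowerObjects.specOK_pin`).  A READING (chair's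
species word asked, note §2 Q4); the bodies of these objects are the object gap of N08. [cite: Balaban1985UV3, Thm 2 p.272, (41) p.266, (47) p.267] -/
def Repr41_47 (S : Scales L) (k : ℕ) : Prop :=
  ∃ (C : B10Assembly.Consts) (W : SectB.TowerObjects S (Node00.SU N)),
    W.toRunObjects = runObjects₀ N 𝔅 c S ∧ Nonempty (B10Assembly.LeafSystem C W.pin.toTowerRun) ∧
      B10.Ineq41 W.pin.toTowerRun k ∧ B10.Ineq47 W.pin.toTowerRun k

/-- **Print's run objects at the constants `c` and the backgrounds `𝔅`**: `runObjects₀` with the (41)∕(47) slot := `Repr41_47`. [cite: Balaban1985UV3, (1)–(6) pp.256–257, Thm 2 p.272] -/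
def runObjectsOfPrint (S : Scales L) : RunObjects S (Node00.SU N) :=
  { runObjects₀ N 𝔅 c S with ineq41_47 := Repr41_47 N 𝔅 c S }

/-- The slot of `runObjectsOfPrint` IS the ∃-representation reading (`rfl`). [cite: Balaban1985UV3, Thm 2 p.272 (bookkeeping)] -/
theorem runObjectsOfPrint_ineq41_47 (S : Scales L) : (runObjectsOfPrint N 𝔅 c S).ineq41_47 = Repr41_47 N 𝔅 c S := rfl

/-- The densities (2) of `runObjectsOfPrint` are those of the slot-free objects (the slot is not read by `ρ_k`; by induction on `k`, each step `rfl`).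
[cite: Balaban1985UV3, (2) p.256 (bookkeeping)] -/
theorem runObjectsOfPrint_rho (S : Scales L) : ∀ k, (runObjectsOfPrint N 𝔅 c S).rho k = (runObjects₀ N 𝔅 c S).rho k
  | 0 => rfl
  | k + 1 => by
    show (TOfPrint N S k).T ((runObjectsOfPrint N 𝔅 c S).rho k) = (TOfPrint N S k).T ((runObjects₀ N 𝔅 c S).rho k)
    rw [runObjectsOfPrint_rho S k]

variable (L) in
/-- **The in-edge b11 closes the spine's minimality binder BY NAME**: if the variational problem of [7] is solvable at every configuration of the domain (4)
([Balaban1985Variational] Thm 1 p. 279 — N08's in-edge b11 for the d = 3 lattices, here the hypothesis `hB11`), then print's run objects at print's own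
backgrounds satisfy `Setting.RunObjects.IsMinimalConfig` («U_k(U) is the minimal configuration constructed in [7]», (5) p. 256 L35–36).
[cite: Balaban1985UV3, (5) p.256; Balaban1985Variational, Thm 1 p.279] -/
theorem isMinimalConfig_ofPrint (S : Scales L)
    (hB11 : ∀ (k : ℕ) (V : GaugeField S.P k (Node00.SU N)), PlaqSmall (eps1OfPrint c S k) V → UkExists3 N S k c.εbg V) :
    (runObjectsOfPrint N (Backgrounds.ofPrint N L) c S).IsMinimalConfig :=
  fun k V hV => isBackground_Uk3 N (hB11 k V hV)

/-- **The run family at the constants `c`**: `S ↦ (runObjectsOfPrint … S).toRunData` on `Theorems.Family L c.eps0` — all lattice approximations (all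
couplings, spacings, volumes) whose terminal spacing is `ε₀ = eps0(g)` (p. 256 L15–18). [cite: Balaban1985UV3, (1)–(5) p.256, p.256 L15–18] -/
def runsAt : Family L c.eps0 → B10.RunData :=
  fun S => (runObjectsOfPrint N 𝔅 c S.1).toRunData

/-- **Thm 1 (compact reading) ∧ Thm 2 AT THE CONSTANTS `c`** — the `b10` leaf's text (`DagDischarged.b10Compact`) over `runsAt N 𝔅 c`. [cite: Balaban1985UV3, Thm 1 p.257, Thm 2 p.272] -/
def b10At : Prop :=
  B10.Thm1PrintedCompact (runsAt N 𝔅 c) ∧ B10.Thm2Printed (runsAt N 𝔅 c)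

variable (L) in
/-- **[Balaban1985UV3] THEOREM 1 (compact-coupling-window reading, cell GAPS G-B10-01) ∧ THEOREM 2 AS PRINTED, on SU(N) with print's own averaging and
transformation and the [7]-minimisers `𝔅`, WITH THEIR PRINTED EXISTENTIAL PREFIX**: there are admissible constants `c` (ε₀(·) «depending on g only», the
vacuum energies `E`, `b₀`, `p₀`) at which the run family satisfies the bounds (5) with one O(1) per compact coupling window (Thm 1 p. 257 with p. 257 L1
«independent of ε, k, g_k in a bounded set») and every `ρ_k`, `k ≤ K`, admits the representation (41), (47) (Thm 2 p. 272, reading `Repr41_47`).  TYPED, NOT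
ASSERTED — this Prop IS the object gap of node N08. [cite: Balaban1985UV3, Thm 1 p.257, Thm 2 p.272] -/
def PrintedUV3 : Prop :=
  ∃ c : Consts L, c.Adm ∧ b10At N 𝔅 c

/-! ### §3a. These ARE the tree's hypothesis-free printed towers; (6) for print's run, hypothesis-free -/

/-- **The densities (2) of print's run on SU(N) ARE lit-balaban's hypothesis-free printed tower** `B10Eq2DensityTower.towerPrintedSUNFree S.P g₀ E` at
`g₀ = g₀` of (1) (`Scales.gk 0`, `g₀² = g²ε` by `gRun_zero_sq`) and `E = c.E S` — by induction on `k` (step `k+1`: the same transformation; step 0: (1)).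
[cite: Balaban1985UV3, (1)–(2) p.256] -/
theorem rho_eq_towerPrintedSUNFree (S : Scales L) : ∀ k,
    (runObjectsOfPrint N 𝔅 c S).rho k = (towerPrintedSUNFree S.P (N := N) (S.gk 0) (c.E S)).ρ k
  | 0 => by
    funext U
    have h0 : S.gk 0 ^ 2 = S.g0sq := gRun_zero_sq S.g (L : ℝ) S.ε S.ε_pos.le
    show Real.exp (-(1 / S.g0sq) * wilsonAction4 U - c.E S) = Real.exp (-(1 / S.gk 0 ^ 2) * wilsonAction4 U - c.E S)
    rw [h0]
  | k + 1 => by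
    show (TOfPrint N S k).T ((runObjectsOfPrint N 𝔅 c S).rho k) = _
    rw [rho_eq_towerPrintedSUNFree S k]
    rfl

/-- **(6) p. 257 for print's run, every `k`, HYPOTHESIS-FREE**: `∫dV_kρ_k = e^{−E}Z_W(g₀)` — lit-balaban's `integral_towerPrintedSUNFree_eq` BY NAME along
`rho_eq_towerPrintedSUNFree`. [cite: Balaban1985UV3, (6) p.257] -/
theorem integral_rho_eq (S : Scales L) (k : ℕ) :
    ∫ V, (runObjectsOfPrint N 𝔅 c S).rho k V ∂(fieldMeasure S.P k (Node00.SU N)) =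
      Real.exp (-(c.E S)) * Step.wilsonZ S.P (Node00.SU N) (S.gk 0) := by
  rw [rho_eq_towerPrintedSUNFree]
  exact integral_towerPrintedSUNFree_eq S.P (S.gk 0) (c.E S) k

/-- **Display (6) in the spine's letters, PROVED for print's run** (`Setting.RunObjects.Eq6`: «∫dUρ_k = ∫dUT^kρ₀ = ∫dUρ₀ = Z^ε» for every `k ≤ K`; the spine
types it and proves nothing — here it is a theorem for the pinned `Ū`, `T`). [cite: Balaban1985UV3, (6) p.257] -/
theorem eq6_runObjectsOfPrint (S : Scales L) : (runObjectsOfPrint N 𝔅 c S).Eq6 := by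
  intro k _
  show _ = ∫ U, (runObjectsOfPrint N 𝔅 c S).rho 0 U ∂(fieldMeasure S.P 0 (Node00.SU N))
  rw [integral_rho_eq, integral_rho_eq]

/-! ### §3b. Transport of (5) along the ∃-representation; uniform leaf systems on print's towers give BOTH printed theorems -/

/-- **Transport of the bounds (5)** p. 256: tower objects EXTENDING the slot-free run objects have the densities, the characteristic functions, the main
term and the couplings ∕ site counts of print's run (the slot is read by none of them; `ρ_k` by `SectB.TowerObjects.pin_rho` and `runObjectsOfPrint_rho`),
so (5) at step `k` for the one is (5) for the other.  Re-derived bookkeeping. [cite: Balaban1985UV3, (5) p.256] -/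
theorem bounds5At_pin_iff_of_eq {S : Scales L} (W : SectB.TowerObjects S (Node00.SU N)) (hW : W.toRunObjects = runObjects₀ N 𝔅 c S)
    (O1 : ℝ) (k : ℕ) :
    B10.Bounds5At W.pin.toTowerRun.toRunData O1 k ↔ B10.Bounds5At (runObjectsOfPrint N 𝔅 c S).toRunData O1 k := by
  have hε : W.pin.toRunObjects.ε₁ = (runObjectsOfPrint N 𝔅 c S).ε₁ := by
    show W.toRunObjects.ε₁ = (runObjects₀ N 𝔅 c S).ε₁
    exact congrArg RunObjects.ε₁ hW
  have hU : W.pin.toRunObjects.Uk = (runObjectsOfPrint N 𝔅 c S).Uk := by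
    show W.toRunObjects.Uk = (runObjects₀ N 𝔅 c S).Uk
    exact congrArg RunObjects.Uk hW
  have hρ : W.pin.toRunObjects.rho k = (runObjectsOfPrint N 𝔅 c S).rho k := by
    rw [SectB.TowerObjects.pin_rho, runObjectsOfPrint_rho]
    exact congrArg (fun R : RunObjects S (Node00.SU N) => R.rho k) hW
  show B10.Bounds5At W.pin.toRunObjects.toRunData O1 k ↔ _
  rw [RunObjects.bounds5At_toRunData_iff, RunObjects.bounds5At_toRunData_iff]
  simp only [RunObjects.chi, RunObjects.mainTerm, hε, hU, hρ]

/-- **UNIFORM LEAF SYSTEMS ON PRINT'S TOWERS at the constants `c`**: ONE family of constants `C : B10Assembly.Consts` and, for every lattice approximation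
of the family, tower objects of Sect. B extending print's (slot-free) run objects whose pieces carry a `B10Assembly.LeafSystem C` — the shape the lane
pub-balaban3d's end theorem and this seat's T1∕T4 (`B10NodeKnit`, `BalabanUVNodesN08Constructed`) produce.  The uniformity of `C` across the family is
Thm 1's «O(1) independent of ε, k» (p. 257 L1). [cite: Balaban1985UV3, Thm 1 p.257, Thm 2 p.272, pp.256–274 (the printed leaves)] -/
def UniformLeafSystems : Prop :=
  ∃ C : B10Assembly.Consts, ∀ S : Family L c.eps0, ∃ W : SectB.TowerObjects S.1 (Node00.SU N),
    W.toRunObjects = runObjects₀ N 𝔅 c S.1 ∧ Nonempty (B10Assembly.LeafSystem C W.pin.toTowerRun)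

/-- **Uniform leaf systems ⇒ Thm 1 (compact) ∧ Thm 2 (∃-representation reading) at `c`** — `B10Assembly.thm1Compact_and_thm2_of_leafSystem` (the cell's
kernel proof of Sect. D «(41), (47) ⇒ (5)» and of Thm 2 from the step leaves) transported to print's run family by `bounds5At_pin_iff_of_eq` and
`SectB.TowerObjects.ineq41_pin_iff ∕ ineq47_pin_iff`. [cite: Balaban1985UV3, Thm 1 p.257, Thm 2 p.272, Sect. D pp.272–275] -/
theorem b10At_of_uniformLeafSystems (h : UniformLeafSystems N 𝔅 c) : b10At N 𝔅 c := by
  obtain ⟨C, hS⟩ := h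
  choose W hW hLS using hS
  have Sys : ∀ S : Family L c.eps0, B10Assembly.LeafSystem C (W S).pin.toTowerRun := fun S => (hLS S).some
  have h12 := B10Assembly.thm1Compact_and_thm2_of_leafSystem (fun S => (W S).pin.toTowerRun) Sys
  refine ⟨?_, ?_⟩
  · intro gmin gmax hmin hle
    obtain ⟨O1, hO1⟩ := h12.1 gmin gmax hmin hle
    exact ⟨O1, fun S k hk h1 h2 => (bounds5At_pin_iff_of_eq N 𝔅 c (W S) (hW S) O1 k).1 (hO1 S k hk h1 h2)⟩
  · intro S k hk
    have h2 : B10.Ineq41 (W S).toTowerRun k ∧ B10.Ineq47 (W S).toTowerRun k := h12.2 S k hk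
    exact ⟨C, W S, hW S, hLS S, ((W S).ineq41_pin_iff k).2 h2.1, ((W S).ineq47_pin_iff k).2 h2.2⟩

variable (L) in
/-- Hence admissible constants with uniform leaf systems give the printed theorems `PrintedUV3`. [cite: Balaban1985UV3, Thm 1 p.257, Thm 2 p.272] -/
theorem printedUV3_of_uniformLeafSystems (h : ∃ c : Consts L, c.Adm ∧ UniformLeafSystems N 𝔅 c) : PrintedUV3 N L 𝔅 := by
  obtain ⟨c, hc, hu⟩ := h
  exact ⟨c, hc, b10At_of_uniformLeafSystems N 𝔅 c hu⟩

end RunObjectsOfPrint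

/-! ## §4. The pin: the constants chosen by the printed existential, and the compact node ⟺ the printed theorems -/

section Pin

variable (N : ℕ) [NeZero N] {L : ℕ} (𝔅 : Consts L → Backgrounds N L)

/-- **The constants OF RECORD** (chair R434 (c2) idiom «total definitions now, properties later» applied to the printed existential «ε₀ is a positive
constant depending on the coupling constant g only», p. 256 L16–17): the constants print's theorems hold at, when such exist (`Classical.choose`), and the
documented junk admissible value otherwise. [cite: Balaban1985UV3, p.256 L15–18, (1) p.256, (7) p.257] -/
def constsOfRecord : Consts L := by
  classical
  exact if h : PrintedUV3 N L 𝔅 then Classical.choose h else Consts.junk L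

/-- The constants of record are admissible (both branches). [cite: Balaban1985UV3, p.256 L15–18 (bookkeeping)] -/
theorem constsOfRecord_adm : (constsOfRecord N 𝔅).Adm := by
  classical
  unfold constsOfRecord
  split_ifs with h
  · exact (Classical.choose_spec h).1
  · exact Consts.junk_adm L

/-- **KERNEL FACT**: the printed theorems hold at the constants of record IFF they hold at some admissible constants — `b10At N 𝔅 (constsOfRecord N 𝔅) ↔
PrintedUV3 N L 𝔅` (the generic `Q x₀ ↔ ∃ x, Q x` for `x₀ := if h : ∃ x, Q x then choose h else junk`). [cite: Balaban1985UV3, Thm 1 p.257, Thm 2 p.272 (bookkeeping over the printed existential)] -/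
theorem b10At_constsOfRecord_iff : b10At N 𝔅 (constsOfRecord N 𝔅) ↔ PrintedUV3 N L 𝔅 := by
  classical
  refine ⟨fun h => ⟨constsOfRecord N 𝔅, constsOfRecord_adm N 𝔅, h⟩, fun h => ?_⟩
  unfold constsOfRecord
  rw [dif_pos h]
  exact (Classical.choose_spec h).2

/-- **THE [B10] RUN FAMILY OF RECORD**: print's run family at the constants of record, on `Family L (constsOfRecord N 𝔅).eps0`. [cite: Balaban1985UV3, (1)–(5) p.256, p.256 L15–18] -/
def runsOfRecord : Family L (constsOfRecord N 𝔅).eps0 → B10.RunData :=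
  runsAt N 𝔅 (constsOfRecord N 𝔅)

/-- `runsOfRecord` IS `runsAt` at the constants of record (`rfl`). [cite: Balaban1985UV3, (1)–(5) p.256 (bookkeeping)] -/
theorem runsOfRecord_eq : runsOfRecord N 𝔅 = runsAt N 𝔅 (constsOfRecord N 𝔅) := rfl

/-- **THE COMPACT NODE OVER CARRIERS WHOSE B10 GROUP IS THE RUN FAMILY OF RECORD ⟺ THE PRINTED THEOREMS**:
`b10Compact (X.withRuns10 (runsOfRecord N 𝔅)) ↔ PrintedUV3 N L 𝔅`. [cite: Balaban1985UV3, Thm 1 p.257 (compact reading) + Thm 2 p.272] -/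
theorem b10Compact_withRuns10_runsOfRecord_iff (X : PrintedCarriersR) :
    b10Compact (X.withRuns10 (runsOfRecord N 𝔅)).toPrintedCarriers ↔ PrintedUV3 N L 𝔅 :=
  (b10Compact_withRuns10_iff X (runsOfRecord N 𝔅)).trans (b10At_constsOfRecord_iff N 𝔅)

end Pin

/-! ## §5. Node N08 at a world bound by the C-binding of record whose residual B10 group IS the run family of record -/

section Node

variable {F : T4Continuum.T4Family} {N : ℕ} [NeZero N] {L : ℕ} (𝔅 : Consts L → Backgrounds N L)

/-- **The `b10` leaf at such a world ⟺ the printed theorems**: if `w.up P = upOfRecord₅C F N θ P` and `θ.res.X P = Xc.withRuns10 (runsOfRecord N 𝔅)` then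
`(leavesP w P).b10 ↔ PrintedUV3 N L 𝔅` (`Node00.upOfRecord₅C_b10_iff`, `carriers₃_withRuns10`, §4). [cite: Balaban1985UV3, Thm 1 p.257 (compact reading) + Thm 2 p.272] -/
theorem leaf_b10_iff_printedUV3 (θ : Node00.Stage5Params F N) {w : WorldP} {P : B12.RunParams}
    (hup : w.up P = Node00.upOfRecord₅C F N θ P) (Xc : PrintedCarriersR) (hX : θ.res.X P = Xc.withRuns10 (runsOfRecord N 𝔅)) :
    (leavesP w P).b10 ↔ PrintedUV3 N L 𝔅 := by
  show (w.up P).b10 ↔ _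
  rw [hup, Node00.upOfRecord₅C_b10_iff, hX]
  exact (b10Compact_withRuns10_runsOfRecord_iff N 𝔅 (Node00.carriers₃ θ.toStage3Params Xc))

/-- **N08 · [Balaban1985UV3] AT SUCH A WORLD, FROM THE PRINTED THEOREMS** (in-edges unused): `PrintedUV3 N L 𝔅 → Dag.B10_main (leavesP w P)`.
What NODE 00's Stage 4 «X.B10» instantiates at every record; the hypothesis is the object gap of N08, nothing else. [cite: Balaban1985UV3, Thm 1 p.257 (compact reading) + Thm 2 p.272] -/
theorem b10_main_of_upOfRecord₅C_runsOfRecord (θ : Node00.Stage5Params F N) {w : WorldP} {P : B12.RunParams}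
    (hup : w.up P = Node00.upOfRecord₅C F N θ P) (Xc : PrintedCarriersR) (hX : θ.res.X P = Xc.withRuns10 (runsOfRecord N 𝔅))
    (h : PrintedUV3 N L 𝔅) : Dag.B10_main (leavesP w P) :=
  fun _ _ _ _ _ _ => (leaf_b10_iff_printedUV3 𝔅 θ hup Xc hX).2 h

/-- **N08 at such a world, EXACTLY**: `Dag.B10_main (leavesP w P)` ⟺ «the in-edge leaves b5, b6, b7, b8, b9, b11 imply the printed theorems».
[cite: Balaban1985UV3, Thm 1 p.257 + Thm 2 p.272 (the node's shape `Dag.B10_main`, bookkeeping)] -/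
theorem b10_main_iff_of_upOfRecord₅C_runsOfRecord (θ : Node00.Stage5Params F N) {w : WorldP} {P : B12.RunParams}
    (hup : w.up P = Node00.upOfRecord₅C F N θ P) (Xc : PrintedCarriersR) (hX : θ.res.X P = Xc.withRuns10 (runsOfRecord N 𝔅)) :
    Dag.B10_main (leavesP w P) ↔
      ((leavesP w P).b5 → (leavesP w P).b6 → (leavesP w P).b7 → (leavesP w P).b8 → (leavesP w P).b9 → (leavesP w P).b11 →
        PrintedUV3 N L 𝔅) := by
  unfold Dag.B10_main
  rw [leaf_b10_iff_printedUV3 𝔅 θ hup Xc hX]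

/-- **The «slots» form over the record predicate OF RECORD** (`Node00.IsRecordOfRecord₅C`, the shape of `B10LeafUnpinnedRecord5C.b10_main_of_isRecordOfRecord₅C_of_slots`):
if at every admissible `θ` binding `w` and every run the residual B10 group is the run family of record, then `PrintedUV3 N L 𝔅` gives N08 at every run.
(For ₅C AS IT STANDS the first hypothesis is not dischargeable — `θ.res.X` is free; it is what Stage 4 turns into a definition.) [cite: Balaban1985UV3, Thm 1 p.257 (compact reading) + Thm 2 p.272 (bookkeeping shape)] -/
theorem b10_main_of_isRecordOfRecord₅C_of_runsOfRecord {D : T4Continuum.FiniteEpsData F (Node00.SU N)} {w : WorldP}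
    (hR : Node00.IsRecordOfRecord₅C F N D w)
    (pin : ∀ θ : Node00.Stage5Params F N, θ.Admissible → D = Node00.datumOfRecord₅ F N θ →
      (∀ P, w.up P = Node00.upOfRecord₅C F N θ P) → ∀ P : B12.RunParams,
        ∃ Xc : PrintedCarriersR, θ.res.X P = Xc.withRuns10 (runsOfRecord N 𝔅))
    (h : PrintedUV3 N L 𝔅) : ∀ P : B12.RunParams, Dag.B10_main (leavesP w P) := by
  intro P
  obtain ⟨θ, hθ, hD, -, -, -, hup⟩ := hR
  obtain ⟨Xc, hX⟩ := pin θ hθ hD hup P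
  exact b10_main_of_upOfRecord₅C_runsOfRecord 𝔅 θ (hup P) Xc hX h

end Node

/-! ## §6. Non-vacuity of the family -/

section NonVacuity

variable {L : ℕ}

/-- **The lattice approximation with coupling `g`, volume exponent `m` and `K` steps at terminal spacing `ε₀ = eps0(g)`** (spacing `ε = ε₀(g)L^{−K}`,
p. 256 L15–18 «L^Kε = ε₀»), for admissible constants `c` and any odd block size `L > 1`. [cite: Balaban1985UV3, p.256 L15–18] -/
def scalesOf (hL : Odd L ∧ 1 < L) (c : Consts L) (hc : c.Adm) (g : ℝ) (hg : 0 < g) (m K : ℕ) : Scales L where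
  hL := hL
  m := m
  K := K
  ε := c.eps0 g / (L : ℝ) ^ K
  ε_pos := div_pos (hc.1 g hg).1 (pow_pos (by exact_mod_cast (lt_trans zero_lt_one hL.2)) K)
  ε₀ := c.eps0 g
  hK := by
    have hLpos : (0 : ℝ) < (L : ℝ) ^ K := pow_pos (by exact_mod_cast (lt_trans zero_lt_one hL.2)) K
    field_simp
  g := g
  g_pos := hg
  gK_le_one := (hc.1 g hg).2

/-- `scalesOf` is a member of the family `Family L c.eps0` (its terminal spacing is `eps0` of its coupling; `rfl`). [cite: Balaban1985UV3, p.256 L15–18 (bookkeeping)] -/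
theorem scalesOf_mem (hL : Odd L ∧ 1 < L) (c : Consts L) (hc : c.Adm) (g : ℝ) (hg : 0 < g) (m K : ℕ) :
    (scalesOf hL c hc g hg m K).ε₀ = c.eps0 (scalesOf hL c hc g hg m K).g := rfl

/-- For every admissible terminal-spacing function, every coupling `g > 0`, every volume exponent `m` and EVERY number of steps `K` there is a lattice
approximation of the family with that coupling, volume exponent and depth (arbitrarily fine lattices at fixed `g`: the family the uniformity «independent of
ε» of Thm 1 is about).  Elementary. [cite: Balaban1985UV3, p.256 L15–18] -/
theorem exists_family_member (hL : Odd L ∧ 1 < L) (c : Consts L) (hc : c.Adm) (g : ℝ) (hg : 0 < g) (m K : ℕ) :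
    ∃ S : Family L c.eps0, S.1.g = g ∧ S.1.m = m ∧ S.1.K = K :=
  ⟨⟨scalesOf hL c hc g hg m K, scalesOf_mem hL c hc g hg m K⟩, rfl, rfl, rfl⟩

/-- The family is inhabited (admissible constants, any odd `L > 1`). [cite: Balaban1985UV3, p.256 L15–18 (bookkeeping)] -/
theorem family_nonempty (hL : Odd L ∧ 1 < L) (c : Consts L) (hc : c.Adm) : Nonempty (Family L c.eps0) :=
  ⟨⟨scalesOf hL c hc 1 one_pos 0 0, scalesOf_mem hL c hc 1 one_pos 0 0⟩⟩

/-- In particular the run family OF RECORD is indexed by an inhabited type (its constants are admissible, `constsOfRecord_adm`). [cite: Balaban1985UV3, p.256 L15–18 (bookkeeping)] -/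
theorem family_constsOfRecord_nonempty (hL : Odd L ∧ 1 < L) (N : ℕ) [NeZero N] (𝔅 : Consts L → Backgrounds N L) :
    Nonempty (Family L (constsOfRecord N 𝔅).eps0) :=
  family_nonempty hL _ (constsOfRecord_adm N 𝔅)

end NonVacuity

/-! ## §7 (v1.1). THE GENERIC PIN over an arbitrary assignment of print's binders `R₀ : Consts L → ∀ S, RunObjects S (SU N)`

v1.1 (same seat, 2026-08-26; APPEND-ONLY — §1–§6 byte-identical).  WHY.  The transformation `TOfPrint` of §3 is — like NODE 00's `TrhoOfRecord` (Stages 5–8)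
and lit-balaban's `towerPrintedSUNFree` — the Radon–Nikodym transport `AveragingRT.rnTransport`, i.e. MATHLIB'S CHOSEN VERSION of an a.e.-class
(`(pushDensity Ū ρ).rnDeriv dV`); the bounds (5) (`B10.Bounds5At`, «∀ U») and (41)∕(47) (`B10.Ineq41 ∕ Ineq47`) are POINTWISE faces, so over THAT
transformation the slot `PrintedUV3` of §3 is not reachable by any witness for `k ≥ 1` — the d = 3 reading of dag-n13-b's STAGE7-POINTWISE certificate and
of the chair's ruling R437 (d) for the T⁴ record (seat line [N08-A-G3-T6-CAVEAT]).  The cure of record is a VERSION-SELECTED transformation (lane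
pub-balaban3d, ruling R-RN: `Summits/QuantumFields/Balaban3D/Carriers/RTSelect.selectVersion` — the transport re-selected inside the step sandwich,
a.e.-equal to it and still `Setup.IsRT`; in print the δ-function formula [Balaban1985Averaging] (10) has continuous fibre integrals, so a.e. = pointwise)
or a REPRESENTED tower (NODE 00 Stage 9).  THIS SECTION re-does §3–§5 over an ARBITRARY assignment `R₀` of print's binders (`E`, `ε₁`, `Ū`, `T`, `reg`,
`U_k`) as a function of the ∃-constants — its own (41)∕(47) slot is ignored (overwritten by the ∃-representation reading) —, so that the pin, the ⟺ and
N08-at-the-pin are available at WHATEVER transformation Stage 4 names; §8 is the instance with THE TRANSFORMATION AS A PIN INPUT `𝔗` along print's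
averaging (§3 = the instance `𝔗 := TOfPrint`, `rfl`), with (6) for every such `𝔗`.  Nothing of the paper asserted. -/

section GenericPin

variable (N : ℕ) [NeZero N] {L : ℕ} (R₀ : Consts L → ∀ S : Scales L, RunObjects S (Node00.SU N)) (c : Consts L)

/-- The ∃-REPRESENTATION READING of «ρ_k satisfies (41), (47)» (Thm 2 p. 272) over the binders `R₀ c S` — `Repr41_47` of §3 with `runObjects₀` replaced
by an arbitrary assignment. [cite: Balaban1985UV3, Thm 2 p.272, (41) p.266, (47) p.267] -/
def Repr41_47G (S : Scales L) (k : ℕ) : Prop :=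
  ∃ (C : B10Assembly.Consts) (W : SectB.TowerObjects S (Node00.SU N)),
    W.toRunObjects = R₀ c S ∧ Nonempty (B10Assembly.LeafSystem C W.pin.toTowerRun) ∧
      B10.Ineq41 W.pin.toTowerRun k ∧ B10.Ineq47 W.pin.toTowerRun k

/-- The run objects `R₀ c S` with the (41)∕(47) slot := the ∃-representation reading. [cite: Balaban1985UV3, (1)–(6) pp.256–257, Thm 2 p.272] -/
def withReprSlot (S : Scales L) : RunObjects S (Node00.SU N) :=
  { R₀ c S with ineq41_47 := Repr41_47G N R₀ c S }

/-- The slot of `withReprSlot` (`rfl`). [cite: Balaban1985UV3, Thm 2 p.272 (bookkeeping)] -/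
theorem withReprSlot_ineq41_47 (S : Scales L) : (withReprSlot N R₀ c S).ineq41_47 = Repr41_47G N R₀ c S := rfl

/-- Re-slotting does not change the densities (2) (induction on `k`). [cite: Balaban1985UV3, (2) p.256 (bookkeeping)] -/
theorem withReprSlot_rho (S : Scales L) : ∀ k, (withReprSlot N R₀ c S).rho k = (R₀ c S).rho k
  | 0 => rfl
  | k + 1 => by
    show ((R₀ c S).T k).T ((withReprSlot N R₀ c S).rho k) = ((R₀ c S).T k).T ((R₀ c S).rho k)
    rw [withReprSlot_rho S k]

/-- The run family at the constants `c` over `R₀`. [cite: Balaban1985UV3, (1)–(5) p.256, p.256 L15–18] -/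
def runsAtG : Family L c.eps0 → B10.RunData :=
  fun S => (withReprSlot N R₀ c S.1).toRunData

/-- Thm 1 (compact reading) ∧ Thm 2 at the constants `c` over `R₀`. [cite: Balaban1985UV3, Thm 1 p.257, Thm 2 p.272] -/
def b10AtG : Prop :=
  B10.Thm1PrintedCompact (runsAtG N R₀ c) ∧ B10.Thm2Printed (runsAtG N R₀ c)

variable (L) in
/-- **[Balaban1985UV3] Thm 1 (compact) ∧ Thm 2 WITH THEIR PRINTED ∃-PREFIX, over the binder assignment `R₀`** (= `PrintedUV3` of §3 at `R₀ := runObjects₀ N 𝔅`).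
TYPED, NOT ASSERTED. [cite: Balaban1985UV3, Thm 1 p.257, Thm 2 p.272] -/
def PrintedUV3G : Prop :=
  ∃ c : Consts L, c.Adm ∧ b10AtG N R₀ c

/-- Transport of the bounds (5) along the ∃-representation, over `R₀` (as `bounds5At_pin_iff_of_eq`). [cite: Balaban1985UV3, (5) p.256] -/
theorem bounds5At_pin_iff_of_eqG {S : Scales L} (W : SectB.TowerObjects S (Node00.SU N)) (hW : W.toRunObjects = R₀ c S) (O1 : ℝ) (k : ℕ) :
    B10.Bounds5At W.pin.toTowerRun.toRunData O1 k ↔ B10.Bounds5At (withReprSlot N R₀ c S).toRunData O1 k := by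
  have hε : W.pin.toRunObjects.ε₁ = (withReprSlot N R₀ c S).ε₁ := by
    show W.toRunObjects.ε₁ = (R₀ c S).ε₁
    exact congrArg RunObjects.ε₁ hW
  have hU : W.pin.toRunObjects.Uk = (withReprSlot N R₀ c S).Uk := by
    show W.toRunObjects.Uk = (R₀ c S).Uk
    exact congrArg RunObjects.Uk hW
  have hρ : W.pin.toRunObjects.rho k = (withReprSlot N R₀ c S).rho k := by
    rw [SectB.TowerObjects.pin_rho, withReprSlot_rho]
    exact congrArg (fun R : RunObjects S (Node00.SU N) => R.rho k) hW
  show B10.Bounds5At W.pin.toRunObjects.toRunData O1 k ↔ _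
  rw [RunObjects.bounds5At_toRunData_iff, RunObjects.bounds5At_toRunData_iff]
  simp only [RunObjects.chi, RunObjects.mainTerm, hε, hU, hρ]

/-- Uniform leaf systems on the runs of `R₀` at the constants `c` (as `UniformLeafSystems`). [cite: Balaban1985UV3, Thm 1 p.257, Thm 2 p.272, pp.256–274 (the printed leaves)] -/
def UniformLeafSystemsG : Prop :=
  ∃ C : B10Assembly.Consts, ∀ S : Family L c.eps0, ∃ W : SectB.TowerObjects S.1 (Node00.SU N),
    W.toRunObjects = R₀ c S.1 ∧ Nonempty (B10Assembly.LeafSystem C W.pin.toTowerRun)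

/-- Uniform leaf systems ⇒ Thm 1 (compact) ∧ Thm 2 (∃-representation reading) at `c`, over `R₀` (as `b10At_of_uniformLeafSystems`).
[cite: Balaban1985UV3, Thm 1 p.257, Thm 2 p.272, Sect. D pp.272–275] -/
theorem b10AtG_of_uniformLeafSystems (h : UniformLeafSystemsG N R₀ c) : b10AtG N R₀ c := by
  obtain ⟨C, hS⟩ := h
  choose W hW hLS using hS
  have Sys : ∀ S : Family L c.eps0, B10Assembly.LeafSystem C (W S).pin.toTowerRun := fun S => (hLS S).some
  have h12 := B10Assembly.thm1Compact_and_thm2_of_leafSystem (fun S => (W S).pin.toTowerRun) Sys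
  refine ⟨?_, ?_⟩
  · intro gmin gmax hmin hle
    obtain ⟨O1, hO1⟩ := h12.1 gmin gmax hmin hle
    exact ⟨O1, fun S k hk h1 h2 => (bounds5At_pin_iff_of_eqG N R₀ c (W S) (hW S) O1 k).1 (hO1 S k hk h1 h2)⟩
  · intro S k hk
    have h2 : B10.Ineq41 (W S).toTowerRun k ∧ B10.Ineq47 (W S).toTowerRun k := h12.2 S k hk
    exact ⟨C, W S, hW S, hLS S, ((W S).ineq41_pin_iff k).2 h2.1, ((W S).ineq47_pin_iff k).2 h2.2⟩

variable (L) in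
/-- Admissible constants with uniform leaf systems give `PrintedUV3G`. [cite: Balaban1985UV3, Thm 1 p.257, Thm 2 p.272] -/
theorem printedUV3G_of_uniformLeafSystems (h : ∃ c : Consts L, c.Adm ∧ UniformLeafSystemsG N R₀ c) : PrintedUV3G N L R₀ := by
  obtain ⟨c, hc, hu⟩ := h
  exact ⟨c, hc, b10AtG_of_uniformLeafSystems N R₀ c hu⟩

end GenericPin

section GenericRecord

variable (N : ℕ) [NeZero N] {L : ℕ} (R₀ : Consts L → ∀ S : Scales L, RunObjects S (Node00.SU N))

/-- **The constants OF RECORD over `R₀`** (the ε-idiom of §4 at an arbitrary binder assignment). [cite: Balaban1985UV3, p.256 L15–18, (1) p.256, (7) p.257] -/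
def constsOfRecordG : Consts L := by
  classical
  exact if h : PrintedUV3G N L R₀ then Classical.choose h else Consts.junk L

/-- The constants of record are admissible. [cite: Balaban1985UV3, p.256 L15–18 (bookkeeping)] -/
theorem constsOfRecordG_adm : (constsOfRecordG N R₀).Adm := by
  classical
  unfold constsOfRecordG
  split_ifs with h
  · exact (Classical.choose_spec h).1
  · exact Consts.junk_adm L

/-- KERNEL FACT: `b10AtG N R₀ (constsOfRecordG N R₀) ↔ PrintedUV3G N L R₀`. [cite: Balaban1985UV3, Thm 1 p.257, Thm 2 p.272 (bookkeeping over the printed existential)] -/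
theorem b10AtG_constsOfRecordG_iff : b10AtG N R₀ (constsOfRecordG N R₀) ↔ PrintedUV3G N L R₀ := by
  classical
  refine ⟨fun h => ⟨constsOfRecordG N R₀, constsOfRecordG_adm N R₀, h⟩, fun h => ?_⟩
  unfold constsOfRecordG
  rw [dif_pos h]
  exact (Classical.choose_spec h).2

/-- **The run family OF RECORD over `R₀`**. [cite: Balaban1985UV3, (1)–(5) p.256, p.256 L15–18] -/
def runsOfRecordG : Family L (constsOfRecordG N R₀).eps0 → B10.RunData :=
  runsAtG N R₀ (constsOfRecordG N R₀)

/-- **`b10Compact (X.withRuns10 (runsOfRecordG N R₀)) ↔ PrintedUV3G N L R₀`.** [cite: Balaban1985UV3, Thm 1 p.257 (compact reading) + Thm 2 p.272] -/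
theorem b10Compact_withRuns10_runsOfRecordG_iff (X : PrintedCarriersR) :
    b10Compact (X.withRuns10 (runsOfRecordG N R₀)).toPrintedCarriers ↔ PrintedUV3G N L R₀ :=
  (b10Compact_withRuns10_iff X (runsOfRecordG N R₀)).trans (b10AtG_constsOfRecordG_iff N R₀)

/-- The run family of record over `R₀` is indexed by an inhabited type (any odd `L > 1`). [cite: Balaban1985UV3, p.256 L15–18 (bookkeeping)] -/
theorem family_constsOfRecordG_nonempty (hL : Odd L ∧ 1 < L) : Nonempty (Family L (constsOfRecordG N R₀).eps0) :=
  family_nonempty hL _ (constsOfRecordG_adm N R₀)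

variable {N} {F : T4Continuum.T4Family}

/-- The `b10` leaf at a world bound by the C-binding of record whose residual B10 group is `runsOfRecordG N R₀` ⟺ `PrintedUV3G N L R₀`.
[cite: Balaban1985UV3, Thm 1 p.257 (compact reading) + Thm 2 p.272] -/
theorem leaf_b10_iff_printedUV3G (θ : Node00.Stage5Params F N) {w : WorldP} {P : B12.RunParams}
    (hup : w.up P = Node00.upOfRecord₅C F N θ P) (Xc : PrintedCarriersR) (hX : θ.res.X P = Xc.withRuns10 (runsOfRecordG N R₀)) :
    (leavesP w P).b10 ↔ PrintedUV3G N L R₀ := by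
  show (w.up P).b10 ↔ _
  rw [hup, Node00.upOfRecord₅C_b10_iff, hX]
  exact (b10Compact_withRuns10_runsOfRecordG_iff N R₀ (Node00.carriers₃ θ.toStage3Params Xc))

/-- **N08 at such a world, from the printed theorems over `R₀`** (in-edges unused). [cite: Balaban1985UV3, Thm 1 p.257 (compact reading) + Thm 2 p.272] -/
theorem b10_main_of_upOfRecord₅C_runsOfRecordG (θ : Node00.Stage5Params F N) {w : WorldP} {P : B12.RunParams}
    (hup : w.up P = Node00.upOfRecord₅C F N θ P) (Xc : PrintedCarriersR) (hX : θ.res.X P = Xc.withRuns10 (runsOfRecordG N R₀))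
    (h : PrintedUV3G N L R₀) : Dag.B10_main (leavesP w P) :=
  fun _ _ _ _ _ _ => (leaf_b10_iff_printedUV3G R₀ θ hup Xc hX).2 h

/-- N08 at such a world, EXACTLY: ⟺ «in-edges ⇒ `PrintedUV3G`». [cite: Balaban1985UV3, Thm 1 p.257 + Thm 2 p.272 (the node's shape `Dag.B10_main`, bookkeeping)] -/
theorem b10_main_iff_of_upOfRecord₅C_runsOfRecordG (θ : Node00.Stage5Params F N) {w : WorldP} {P : B12.RunParams}
    (hup : w.up P = Node00.upOfRecord₅C F N θ P) (Xc : PrintedCarriersR) (hX : θ.res.X P = Xc.withRuns10 (runsOfRecordG N R₀)) :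
    Dag.B10_main (leavesP w P) ↔
      ((leavesP w P).b5 → (leavesP w P).b6 → (leavesP w P).b7 → (leavesP w P).b8 → (leavesP w P).b9 → (leavesP w P).b11 →
        PrintedUV3G N L R₀) := by
  unfold Dag.B10_main
  rw [leaf_b10_iff_printedUV3G R₀ θ hup Xc hX]

/-- The «slots» form over `Node00.IsRecordOfRecord₅C` for the generic pin. [cite: Balaban1985UV3, Thm 1 p.257 (compact reading) + Thm 2 p.272 (bookkeeping shape)] -/
theorem b10_main_of_isRecordOfRecord₅C_of_runsOfRecordG {D : T4Continuum.FiniteEpsData F (Node00.SU N)} {w : WorldP}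
    (hR : Node00.IsRecordOfRecord₅C F N D w)
    (pin : ∀ θ : Node00.Stage5Params F N, θ.Admissible → D = Node00.datumOfRecord₅ F N θ →
      (∀ P, w.up P = Node00.upOfRecord₅C F N θ P) → ∀ P : B12.RunParams,
        ∃ Xc : PrintedCarriersR, θ.res.X P = Xc.withRuns10 (runsOfRecordG N R₀))
    (h : PrintedUV3G N L R₀) : ∀ P : B12.RunParams, Dag.B10_main (leavesP w P) := by
  intro P
  obtain ⟨θ, hθ, hD, -, -, -, hup⟩ := hR
  obtain ⟨Xc, hX⟩ := pin θ hθ hD hup P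
  exact b10_main_of_upOfRecord₅C_runsOfRecordG R₀ θ (hup P) Xc hX h

end GenericRecord

/-! ## §8 (v1.1). THE TRANSFORMATION AS A PIN INPUT: print's binders at an arbitrary renormalization transform `𝔗` along print's averaging -/

section TransformationInput

variable (N : ℕ) [NeZero N] {L : ℕ}
  (𝔗 : ∀ S : Scales L, ∀ j, RTOpI S.P j (Node00.SU N) (avOfPrint N S j)) (𝔅 : Consts L → Backgrounds N L)

/-- **Print's binders with the transformation `𝔗` as input**: `E := c.E S`, `ε₁` by (7), `Ū` := print's `avOfPrint`, `T := 𝔗 S` (ANY renormalization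
transform of [Balaban1985Averaging] (10) along print's averaging — the Radon–Nikodym transport `TOfPrint`, a selected version of it (R-RN), …), `reg ∕ U_k := 𝔅 c`,
slot `True` (re-slotted by `withReprSlot`). [cite: Balaban1985UV3, (1)–(6) pp.256–257; Balaban1985Averaging, (10) p.19] -/
def runObjects₀T : Consts L → ∀ S : Scales L, RunObjects S (Node00.SU N) :=
  fun c S =>
    { E := c.E S
      ε₁ := eps1OfPrint c S
      av := avOfPrint N S
      T := 𝔗 S
      reg := (𝔅 c).reg S
      Uk := (𝔅 c).Uk S
      ineq41_47 := fun _ => True }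

/-- §3 IS the instance `𝔗 := TOfPrint` (`rfl`). [cite: Balaban1985UV3, (2) p.256 (bookkeeping)] -/
theorem runObjects₀T_TOfPrint (c : Consts L) (S : Scales L) : runObjects₀T N (TOfPrint N) 𝔅 c S = runObjects₀ N 𝔅 c S := rfl

/-- … with the same re-slotted run objects (`rfl`). [cite: Balaban1985UV3, Thm 2 p.272 (bookkeeping)] -/
theorem withReprSlot_TOfPrint (c : Consts L) (S : Scales L) :
    withReprSlot N (runObjects₀T N (TOfPrint N) 𝔅) c S = runObjectsOfPrint N 𝔅 c S := rfl

variable (L) in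
/-- … hence the same printed-theorems Prop: `PrintedUV3G N L (runObjects₀T N (TOfPrint N) 𝔅) ↔ PrintedUV3 N L 𝔅` (`Iff.rfl`). [cite: Balaban1985UV3, Thm 1 p.257, Thm 2 p.272 (bookkeeping)] -/
theorem printedUV3G_TOfPrint_iff : PrintedUV3G N L (runObjects₀T N (TOfPrint N) 𝔅) ↔ PrintedUV3 N L 𝔅 := Iff.rfl

/-- **The densities over `𝔗` ARE the cell's tower (1)–(2) along `𝔗`** (`B10Eq2DensityTower.tower (𝔗 S) g₀ E` at `g₀ = g_0`, `E = c.E S`; induction on `k`).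
[cite: Balaban1985UV3, (1)–(2) p.256] -/
theorem rho_eq_towerT (c : Consts L) (S : Scales L) : ∀ k,
    (withReprSlot N (runObjects₀T N 𝔗 𝔅) c S).rho k = (tower (𝔗 S) (S.gk 0) (c.E S)).ρ k
  | 0 => by
    funext U
    have h0 : S.gk 0 ^ 2 = S.g0sq := gRun_zero_sq S.g (L : ℝ) S.ε S.ε_pos.le
    show Real.exp (-(1 / S.g0sq) * wilsonAction4 U - c.E S) = Real.exp (-(1 / S.gk 0 ^ 2) * wilsonAction4 U - c.E S)
    rw [h0]
  | k + 1 => by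
    show ((𝔗 S) k).T ((withReprSlot N (runObjects₀T N 𝔗 𝔅) c S).rho k) = _
    rw [rho_eq_towerT c S k]
    rfl

/-- **(6) p. 257 for the run at ANY renormalization transform `𝔗` along print's averaging** (from the push-forward identity `Setup.IsRT` each `𝔗 S j` carries —
the cell's `integral_tower_eq_wilsonZ`): `∫dV_kρ_k = e^{−E}Z_W(g₀)` for every `k`. [cite: Balaban1985UV3, (6) p.257] -/
theorem integral_rhoT_eq (c : Consts L) (S : Scales L) (k : ℕ) :
    ∫ V, (withReprSlot N (runObjects₀T N 𝔗 𝔅) c S).rho k V ∂(fieldMeasure S.P k (Node00.SU N)) =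
      Real.exp (-(c.E S)) * Step.wilsonZ S.P (Node00.SU N) (S.gk 0) := by
  rw [rho_eq_towerT]
  exact integral_tower_eq_wilsonZ (𝔗 S) (S.gk 0) (c.E S) measurable_wilsonAction4_of_regular k

/-- **Display (6) in the spine's letters for the run at ANY `𝔗`** (`Setting.RunObjects.Eq6`). [cite: Balaban1985UV3, (6) p.257] -/
theorem eq6T (c : Consts L) (S : Scales L) : (withReprSlot N (runObjects₀T N 𝔗 𝔅) c S).Eq6 := by
  intro k _
  show _ = ∫ U, (withReprSlot N (runObjects₀T N 𝔗 𝔅) c S).rho 0 U ∂(fieldMeasure S.P 0 (Node00.SU N))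
  rw [integral_rhoT_eq, integral_rhoT_eq]

variable (L) in
/-- In-edge b11 ⇒ the spine's `IsMinimalConfig` for the run over `𝔗` at print's own backgrounds (as `isMinimalConfig_ofPrint`; the minimality binder does not read
`T`). [cite: Balaban1985UV3, (5) p.256; Balaban1985Variational, Thm 1 p.279] -/
theorem isMinimalConfig_T_ofPrint (c : Consts L) (S : Scales L)
    (hB11 : ∀ (k : ℕ) (V : GaugeField S.P k (Node00.SU N)), PlaqSmall (eps1OfPrint c S k) V → UkExists3 N S k c.εbg V) :
    (withReprSlot N (runObjects₀T N 𝔗 (Backgrounds.ofPrint N L)) c S).IsMinimalConfig :=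
  fun k V hV => isBackground_Uk3 N (hB11 k V hV)

end TransformationInput

/-! ## §9 (v1.2). THE AVERAGING AS A PIN INPUT TOO: print's binders at an ARBITRARY averaging family `𝔞` and an arbitrary renormalization transform `𝔗` along it
(chair R451 (C)∕(E), pub-ymgap 2026-08-26: N08 «as printed» reads (2)'s averaging in Bałaban's PRINTED axiomatic class — [Balaban1985UV3] p. 256 L10 «T described in
[1,4]», [Balaban1985Averaging] (11) + (14) p. 19, [Balaban1987RG1] pp. 253–254 «many other definitions» —; the primed slot `PrintedUV3V′` over an ADMISSIBILITY
PREDICATE on `𝔞` is the NODE 00 definer lineage's to type (R451 (C1)–(C2)); this section supplies only the generic binder assignment it quantifies over, with §8 as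
its `𝔞 := avOfPrint` instance by `rfl`.  Nothing is re-pointed: `avOfPrint`, `runObjects₀T`, `PrintedUV3G` and NODE 00's `PrintedUV3V` are untouched.  LOCATED
RE-READ (R451 (C3)): print's OWN [B11] minimisers `Backgrounds.ofPrint` are tied to print's averaging — `IsBackground` reads `Ū` («Ū_k(U_k(V)) = V») through
`bgReg3 ∕ Uk3` at `avOfPrint` —, so §8's `isMinimalConfig_T_ofPrint` has NO analogue at a general `𝔞`: a supplier along another member of the class reads the b11
in-edge ([Balaban1985Variational] Thm 1) AT `𝔞`, with a background assignment `𝔅` built there.) -/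

section AveragingInput

variable (N : ℕ) [NeZero N] {L : ℕ}
  (𝔞 : ∀ S : Scales L, ∀ j, Averaging S.P j (Node00.SU N))
  (𝔗 : ∀ S : Scales L, ∀ j, RTOpI S.P j (Node00.SU N) (𝔞 S j)) (𝔅 : Consts L → Backgrounds N L)

/-- **Print's binders with the AVERAGING `𝔞` and the transformation `𝔗` as inputs**: `E := c.E S`, `ε₁` by (7), `Ū := 𝔞 S` (ANY averaging family in the sense of
the tree's `Setup.Averaging` — covariant and local in the standing range, [Balaban1985Averaging] (11)), `T := 𝔗 S` (ANY renormalization transform of (10) along `𝔞 S`),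
`reg ∕ U_k := 𝔅 c`, slot `True` (re-slotted by `withReprSlot`).  The admissibility of `𝔞` in print's sense ((14) etc.) is NOT a field here — it belongs to the
primed slot's predicate (R451 (C1)). [cite: Balaban1985UV3, (1)–(6) pp.256–257, p.256 L10; Balaban1985Averaging, (10)–(11) p.19; Balaban1987RG1, (0.5)–(0.7) p.253, p.254] -/
def runObjects₀A : Consts L → ∀ S : Scales L, RunObjects S (Node00.SU N) :=
  fun c S =>
    { E := c.E S
      ε₁ := eps1OfPrint c S
      av := 𝔞 S
      T := 𝔗 S
      reg := (𝔅 c).reg S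
      Uk := (𝔅 c).Uk S
      ineq41_47 := fun _ => True }

variable (𝔗₀ : ∀ S : Scales L, ∀ j, RTOpI S.P j (Node00.SU N) (avOfPrint N S j))

/-- §8 IS the instance `𝔞 := avOfPrint N` (`rfl`): the slot of record's binders are the print-averaging member of the class. [cite: Balaban1985UV3, (2) p.256 (bookkeeping)] -/
theorem runObjects₀A_avOfPrint : runObjects₀A N (avOfPrint N) 𝔗₀ 𝔅 = runObjects₀T N 𝔗₀ 𝔅 := rfl

/-- … hence the same re-slotted run objects (`rfl`) … [cite: Balaban1985UV3, Thm 2 p.272 (bookkeeping)] -/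
theorem withReprSlot_runObjects₀A_avOfPrint (c : Consts L) (S : Scales L) :
    withReprSlot N (runObjects₀A N (avOfPrint N) 𝔗₀ 𝔅) c S = withReprSlot N (runObjects₀T N 𝔗₀ 𝔅) c S := rfl

variable (L) in
/-- … and the same printed-theorems Prop: `PrintedUV3G N L (runObjects₀A N (avOfPrint N) 𝔗₀ 𝔅) ↔ PrintedUV3G N L (runObjects₀T N 𝔗₀ 𝔅)` (`Iff.rfl`) — every supplier of the
slot of record is a supplier at the print-averaging member of the class, and conversely. [cite: Balaban1985UV3, Thm 1 p.257, Thm 2 p.272 (bookkeeping)] -/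
theorem printedUV3G_runObjects₀A_avOfPrint_iff :
    PrintedUV3G N L (runObjects₀A N (avOfPrint N) 𝔗₀ 𝔅) ↔ PrintedUV3G N L (runObjects₀T N 𝔗₀ 𝔅) := Iff.rfl

/-- §3 IS the instance `(𝔞, 𝔗) := (avOfPrint N, TOfPrint N)` (`rfl`). [cite: Balaban1985UV3, (2) p.256 (bookkeeping)] -/
theorem runObjects₀A_avOfPrint_TOfPrint (c : Consts L) (S : Scales L) : runObjects₀A N (avOfPrint N) (TOfPrint N) 𝔅 c S = runObjects₀ N 𝔅 c S := rfl

/-- **The densities over `(𝔞, 𝔗)` ARE the cell's tower (1)–(2) along `𝔗`** (`B10Eq2DensityTower.tower (𝔗 S) g₀ E` at `g₀ = g_0`, `E = c.E S`; induction on `k`;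
the tower does not read the averaging except through `𝔗`'s type). [cite: Balaban1985UV3, (1)–(2) p.256] -/
theorem rho_eq_towerA (c : Consts L) (S : Scales L) : ∀ k,
    (withReprSlot N (runObjects₀A N 𝔞 𝔗 𝔅) c S).rho k = (tower (𝔗 S) (S.gk 0) (c.E S)).ρ k
  | 0 => by
    funext U
    have h0 : S.gk 0 ^ 2 = S.g0sq := gRun_zero_sq S.g (L : ℝ) S.ε S.ε_pos.le
    show Real.exp (-(1 / S.g0sq) * wilsonAction4 U - c.E S) = Real.exp (-(1 / S.gk 0 ^ 2) * wilsonAction4 U - c.E S)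
    rw [h0]
  | k + 1 => by
    show ((𝔗 S) k).T ((withReprSlot N (runObjects₀A N 𝔞 𝔗 𝔅) c S).rho k) = _
    rw [rho_eq_towerA c S k]
    rfl

/-- **(6) p. 257 for the run at ANY averaging `𝔞` and ANY renormalization transform `𝔗` along it** — from the push-forward identity `Setup.IsRT` alone (the
integrated identity `∫dV Tρ = ∫dU ρ` holds for every averaging: [Balaban1985UV3] (6) «by normalization identities»; no Haar-compatibility of `𝔞` is used).
[cite: Balaban1985UV3, (6) p.257] -/
theorem integral_rhoA_eq (c : Consts L) (S : Scales L) (k : ℕ) :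
    ∫ V, (withReprSlot N (runObjects₀A N 𝔞 𝔗 𝔅) c S).rho k V ∂(fieldMeasure S.P k (Node00.SU N)) =
      Real.exp (-(c.E S)) * Step.wilsonZ S.P (Node00.SU N) (S.gk 0) := by
  rw [rho_eq_towerA]
  exact integral_tower_eq_wilsonZ (𝔗 S) (S.gk 0) (c.E S) measurable_wilsonAction4_of_regular k

/-- **Display (6) in the spine's letters for the run at ANY `(𝔞, 𝔗)`** (`Setting.RunObjects.Eq6`). [cite: Balaban1985UV3, (6) p.257] -/
theorem eq6A (c : Consts L) (S : Scales L) : (withReprSlot N (runObjects₀A N 𝔞 𝔗 𝔅) c S).Eq6 := by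
  intro k _
  show _ = ∫ U, (withReprSlot N (runObjects₀A N 𝔞 𝔗 𝔅) c S).rho 0 U ∂(fieldMeasure S.P 0 (Node00.SU N))
  rw [integral_rhoA_eq, integral_rhoA_eq]

variable (L) in
/-- **THE SUPPLIER SOCKET AT ANY `(𝔞, 𝔗)`** (§7's `printedUV3G_of_uniformLeafSystems` at `R₀ := runObjects₀A N 𝔞 𝔗 𝔅`, restated for discoverability; no new
content): admissible ∃-constants with uniform leaf systems on the runs over `(𝔞, 𝔗)` give the printed pair of theorems there.  This is the antecedent a lane END theorem
proved along an ADMISSIBLE averaging `𝔞` of print's class would inhabit — R451 (C3): its in-edge faces are then read AT `𝔞`.  (The axial ∕ decimation family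
`AveragingRT.stdAvg`, along which exact Haar compatibility IS a theorem, linearises to the field along the central line only and so does NOT meet [Balaban1985Averaging]
(14); it is a member of `Setup.Averaging`, not of print's (11)+(14) class — seat note `N08-PRIMED-SLOT-DRAFT.md` (P5).) [cite: Balaban1985UV3, Thm 1 p.257, Thm 2 p.272, Sect. D pp.272–275; Balaban1985Averaging, (14) p.19] -/
theorem printedUV3G_A_of_uniformLeafSystems (h : ∃ c : Consts L, c.Adm ∧ UniformLeafSystemsG N (runObjects₀A N 𝔞 𝔗 𝔅) c) :
    PrintedUV3G N L (runObjects₀A N 𝔞 𝔗 𝔅) :=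
  printedUV3G_of_uniformLeafSystems N L _ h

end AveragingInput

/-! ### §9′ (v1.2). Print's backgrounds AT AN AVERAGING `𝔞`: def-B's idiom of §3′ with `Ū := 𝔞 S` — the b11 in-edge ([Balaban1985Variational] Thm 1) READ AT `𝔞`
(R451 (C3)'s located re-read, typed: the variational problem «`A(U) → min` on `{U : Ū^k = V}`» names the averaging); `𝔞 := avOfPrint N` gives §3′ back by `rfl`. -/

section BackgroundsAtAveraging

variable (N : ℕ) [NeZero N] {L : ℕ} (𝔞 : ∀ S : Scales L, ∀ j, Averaging S.P j (Node00.SU N))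

/-- **«there exists … a minimal orbit» at d = 3 ALONG THE AVERAGING `𝔞`** — the existence clause of [Balaban1985Variational] Thm 1 as a named Prop, with the constraint
`Ū^k = V` read through `𝔞 S` (`Setup.IsBackground (𝔞 S) …`); `UkExists3` is its `𝔞 := avOfPrint N` instance.  A hypothesis wherever used, never asserted.
[cite: Balaban1985Variational, Thm 1 p.279; Balaban1985UV3, (5) p.256] -/
def UkExistsA (S : Scales L) (k : ℕ) (εbg : ℝ) (V : GaugeField S.P k (Node00.SU N)) : Prop :=
  ∃ U₀ : GaugeField S.P 0 (Node00.SU N), IsBackground (𝔞 S) (bgReg3 N S k εbg) k V U₀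

/-- **`U_k(V)` at d = 3 ALONG `𝔞`**: a solution of the variational problem when one exists (`UkExistsA`), the unit configuration otherwise (def-B's idiom, chair R434 (c2));
`Uk3` is its `𝔞 := avOfPrint N` instance. [cite: Balaban1985UV3, (5) p.256; Balaban1985Variational, Thm 1 p.279] -/
def UkA (S : Scales L) (k : ℕ) (εbg : ℝ) (V : GaugeField S.P k (Node00.SU N)) : GaugeField S.P 0 (Node00.SU N) := by
  classical
  exact if h : UkExistsA N 𝔞 S k εbg V then Classical.choose h else 1

/-- The characterising property: whenever the problem at `V` is solvable along `𝔞`, `UkA … V` IS a minimiser within the regular class. [cite: Balaban1985Variational, Thm 1 p.279] -/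
theorem isBackground_UkA {S : Scales L} {k : ℕ} {εbg : ℝ} {V : GaugeField S.P k (Node00.SU N)} (h : UkExistsA N 𝔞 S k εbg V) :
    IsBackground (𝔞 S) (bgReg3 N S k εbg) k V (UkA N 𝔞 S k εbg V) := by
  classical
  unfold UkA
  rw [dif_pos h]
  exact Classical.choose_spec h

/-- Off the solvable set `UkA` is the unit configuration (documented junk default). [cite: Balaban1985Variational, Thm 1 p.279 (bookkeeping)] -/
theorem UkA_of_not {S : Scales L} {k : ℕ} {εbg : ℝ} {V : GaugeField S.P k (Node00.SU N)} (h : ¬ UkExistsA N 𝔞 S k εbg V) :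
    UkA N 𝔞 S k εbg V = 1 := by
  classical
  unfold UkA
  rw [dif_neg h]

variable (L) in
/-- **PRINT'S BACKGROUNDS AT THE AVERAGING `𝔞`** as a function of the construction's constants: `reg := bgReg3` (averaging-free), `U_k := UkA 𝔞`.
[cite: Balaban1985UV3, (5) p.256; Balaban1985Variational, Thm 1 p.279] -/
def Backgrounds.ofAvg : Consts L → Backgrounds N L :=
  fun c => ⟨fun S k => bgReg3 N S k c.εbg, fun S k V => UkA N 𝔞 S k c.εbg V⟩

variable (L) in
/-- §3′ IS the instance `𝔞 := avOfPrint N`: `UkExistsA (avOfPrint N) = UkExists3`, `UkA (avOfPrint N) = Uk3`, `Backgrounds.ofAvg (avOfPrint N) = Backgrounds.ofPrint` (all `rfl`).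
[cite: Balaban1985UV3, (5) p.256 (bookkeeping)] -/
theorem Backgrounds.ofAvg_avOfPrint : Backgrounds.ofAvg N L (avOfPrint N) = Backgrounds.ofPrint N L := rfl

variable (𝔗 : ∀ S : Scales L, ∀ j, RTOpI S.P j (Node00.SU N) (𝔞 S j))

variable (L) in
/-- **In-edge b11 READ AT `𝔞` ⇒ the spine's `IsMinimalConfig` for the run over `(𝔞, 𝔗)` at print's backgrounds at `𝔞`** (the analogue of §8's
`isMinimalConfig_T_ofPrint` that a general member of the class admits: the minimality binder reads `Ū`, so the b11 hypothesis is stated along `𝔞`).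
[cite: Balaban1985UV3, (5) p.256; Balaban1985Variational, Thm 1 p.279] -/
theorem isMinimalConfig_A_ofAvg (c : Consts L) (S : Scales L)
    (hB11 : ∀ (k : ℕ) (V : GaugeField S.P k (Node00.SU N)), PlaqSmall (eps1OfPrint c S k) V → UkExistsA N 𝔞 S k c.εbg V) :
    (withReprSlot N (runObjects₀A N 𝔞 𝔗 (Backgrounds.ofAvg N L 𝔞)) c S).IsMinimalConfig :=
  fun k V hV => isBackground_UkA N 𝔞 (hB11 k V hV)

end BackgroundsAtAveraging

end Literature.MathematicalPhysics.QuantumFieldTheory.Balaban1983to89.B10RunsOfRecord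

end
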